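import Summits.Ventures.PercRepro.ProfilePointedCircuitClassesStarNine

/-!
# PercRepro — SERIES PAIRS AND COLOOP-FREENESS UNDER THE MINORS `N ／ b ∖ b'` AND `N ／ a` (p5, gen 52;
`proofs/P5-GM1.md` §79 ADDENDUM 2)

Three bookkeeping facts for the modules StarSharpC / StarSharpD: on a coloop-free matroid with a series pair `{b, b'}`
through whose second point no further series pair passes, (i) a second disjoint series pair `{c, c'}` survives in the
minor `N ／ b ∖ b'` (`seriesPair_minor_of_seriesPair`), (ii) the minor is coloop-free (`rk_erase_minor_eq_of_seriesPair`:
a point `z` of the minor is a coloop there iff `ρ_N(E − b' − z) < ρ(E)`, i.e. iff `{b', z}` is a series pair), and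
(iii) a series pair of a contraction `N ／ a` is a series pair of `N` (`seriesPair_of_seriesPair_contract`, the converse
of StarNine's `seriesPair_contract_of_ne`).
-/

open scoped Matroid

namespace PercRepro.Cogirth

open Finset ThmH Skew Shadow Profile

variable {α : Type} [DecidableEq α] {N : Matroid α} [N.Finite]

section StarSharpM

/-- On a coloop-free matroid, a second series pair `{c, c'}` survives in the minor `N ／ b ∖ b'` of a first one when no
series pair `{b', x}` with `x ≠ b` exists (no series class of size `≥ 3` through `b'`). -/
theorem seriesPair_minor_of_seriesPair {b b' c c' : α} (h : SeriesPair N b b') (h' : SeriesPair N c c')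
    (hcf : ∀ x ∈ gr N, rk N ((gr N).erase x) = rk N (gr N)) (hbc : b ≠ c) (hbc' : b ≠ c') (hb'c : b' ≠ c)
    (hb'c' : b' ≠ c') (hno : ∀ x ∈ gr N, x ≠ b → ¬ SeriesPair N b' x) :
    SeriesPair ((N ／ ({b} : Set α)) ＼ ({b'} : Set α)) c c' := by
  have hb : b ∈ gr N := h.1
  have hb' : b' ∈ gr N := h.2.1
  have hc : c ∈ gr N := h'.1
  have hc' : c' ∈ gr N := h'.2.1
  have hcc' : c ≠ c' := h'.2.2.1
  have hb1 := rk_singleton_eq_one_of_seriesPair h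
  have hgr := gr_minor_of_seriesPair (N := N) b b'
  have hRm := rk_gr_minor_add_one_of_seriesPair h
  -- `ρ_N(E − b' − x) = ρ(E)` for `x ∈ {c, c'}` (no series pair `{b', x}`)
  have hnp : ∀ x ∈ gr N, x ≠ b → x ≠ b' → rk N (((gr N).erase b').erase x) = rk N (gr N) := by
    intro x hx hxb hxb'
    have hle : rk N (((gr N).erase b').erase x) ≤ rk N (gr N) :=
      rk_mono' (M := N) ((erase_subset _ _).trans (erase_subset _ _))
    have hge : rk N ((gr N).erase b') ≤ rk N (((gr N).erase b').erase x) + 1 := by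
      have := rk_insert_le (M := N) x (((gr N).erase b').erase x)
      rwa [insert_erase (mem_erase.2 ⟨hxb', hx⟩)] at this
    rw [h.2.2.2.2.1] at hge
    by_contra hne
    have h6 : rk N (((gr N).erase b').erase x) + 1 = rk N (gr N) := by omega
    exact hno x hx hxb ⟨hb', hx, hxb'.symm, h.2.2.2.2.1, hcf x hx, h6⟩
  -- the minor's rank function on the relevant sets (ground set rewritten once)
  unfold SeriesPair
  rw [hgr]
  rw [hgr] at hRm
  have key : ∀ x ∈ gr N, x ≠ b → x ≠ b' →
      rk ((N ／ ({b} : Set α)) ＼ ({b'} : Set α)) ((((gr N).erase b).erase b').erase x) + 1 =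
        rk N (((gr N).erase b').erase x) := by
    intro x hx hxb hxb'
    have hY : (((gr N).erase b).erase b').erase x ⊆ gr ((N ／ ({b} : Set α)) ＼ ({b'} : Set α)) := by
      rw [hgr]; exact erase_subset _ _
    have := rk_minor_add_one (N := N) (x := b) (w := b') hb1 hY
    have e1 : insert b ((((gr N).erase b).erase b').erase x) = ((gr N).erase b').erase x := by
      ext y
      simp only [mem_insert, mem_erase]
      constructor
      · rintro (rfl | ⟨hyx, hyb', _, hyg⟩)
        · exact ⟨hxb.symm, h.2.2.1, hb⟩
        · exact ⟨hyx, hyb', hyg⟩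
      · rintro ⟨hyx, hyb', hyg⟩
        by_cases hyb : y = b
        · exact Or.inl hyb
        · exact Or.inr ⟨hyx, hyb', hyb, hyg⟩
    rw [e1] at this
    exact this
  have key2 : rk ((N ／ ({b} : Set α)) ＼ ({b'} : Set α)) (((((gr N).erase b).erase b').erase c).erase c') + 1 =
      rk N ((((gr N).erase b').erase c).erase c') := by
    have hY : ((((gr N).erase b).erase b').erase c).erase c' ⊆ gr ((N ／ ({b} : Set α)) ＼ ({b'} : Set α)) := by
      rw [hgr]; exact (erase_subset _ _).trans (erase_subset _ _)
    have := rk_minor_add_one (N := N) (x := b) (w := b') hb1 hY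
    have e1 : insert b (((((gr N).erase b).erase b').erase c).erase c') = (((gr N).erase b').erase c).erase c' := by
      ext y
      simp only [mem_insert, mem_erase]
      constructor
      · rintro (rfl | ⟨hyc', hyc, hyb', _, hyg⟩)
        · exact ⟨hbc', hbc, h.2.2.1, hb⟩
        · exact ⟨hyc', hyc, hyb', hyg⟩
      · rintro ⟨hyc', hyc, hyb', hyg⟩
        by_cases hyb : y = b
        · exact Or.inl hyb
        · exact Or.inr ⟨hyc', hyc, hyb', hyb, hyg⟩
    rw [e1] at this
    exact this
  -- `ρ_N(E − b' − c − c') + 1 = ρ_N(E − b' − c)` by the series pair `{c, c'}`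
  have hdrop : rk N ((((gr N).erase b').erase c).erase c') + 1 = rk N (((gr N).erase b').erase c) := by
    have hsub : (((gr N).erase b').erase c).erase c' ⊆ ((gr N).erase c).erase c' := by
      intro y hy
      simp only [mem_erase] at hy ⊢
      exact ⟨hy.1, hy.2.1, hy.2.2.2⟩
    have := rk_insert_right_eq_add_one_of_seriesPair h' hsub
    rw [insert_erase (mem_erase.2 ⟨hcc'.symm, mem_erase.2 ⟨hb'c'.symm, hc'⟩⟩)] at this
    omega
  have k1 := key c hc hbc.symm hb'c.symm
  have k2 := key c' hc' hbc'.symm hb'c'.symm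
  have k3 := hnp c hc hbc.symm hb'c.symm
  have k4 := hnp c' hc' hbc'.symm hb'c'.symm
  refine ⟨mem_erase.2 ⟨hb'c.symm, mem_erase.2 ⟨hbc.symm, hc⟩⟩,
    mem_erase.2 ⟨hb'c'.symm, mem_erase.2 ⟨hbc'.symm, hc'⟩⟩, hcc', ?_, ?_, ?_⟩ <;> omega

/-- On a coloop-free matroid the minor `N ／ b ∖ b'` of a series pair is coloop-free unless some `{b', x}`, `x ≠ b`,
is a second series pair. -/
theorem rk_erase_minor_eq_of_seriesPair {b b' : α} (h : SeriesPair N b b')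
    (hcf : ∀ x ∈ gr N, rk N ((gr N).erase x) = rk N (gr N))
    (hno : ∀ x ∈ gr N, x ≠ b → ¬ SeriesPair N b' x) :
    ∀ z ∈ gr ((N ／ ({b} : Set α)) ＼ ({b'} : Set α)),
      rk ((N ／ ({b} : Set α)) ＼ ({b'} : Set α)) ((gr ((N ／ ({b} : Set α)) ＼ ({b'} : Set α))).erase z) =
        rk ((N ／ ({b} : Set α)) ＼ ({b'} : Set α)) (gr ((N ／ ({b} : Set α)) ＼ ({b'} : Set α))) := by
  intro z hz
  have hb : b ∈ gr N := h.1
  have hb' : b' ∈ gr N := h.2.1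
  have hb1 := rk_singleton_eq_one_of_seriesPair h
  have hgr := gr_minor_of_seriesPair (N := N) b b'
  have hRm := rk_gr_minor_add_one_of_seriesPair h
  have hY : (gr ((N ／ ({b} : Set α)) ＼ ({b'} : Set α))).erase z ⊆
      gr ((N ／ ({b} : Set α)) ＼ ({b'} : Set α)) := erase_subset _ _
  have h1 := rk_minor_add_one (N := N) (x := b) (w := b') hb1 hY
  rw [hgr] at hz h1 hRm ⊢
  have hzb' : z ≠ b' := (mem_erase.1 hz).1
  have hzb : z ≠ b := (mem_erase.1 (mem_erase.1 hz).2).1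
  have hzg : z ∈ gr N := (mem_erase.1 (mem_erase.1 hz).2).2
  have e1 : insert b ((((gr N).erase b).erase b').erase z) = ((gr N).erase b').erase z := by
    ext y
    simp only [mem_insert, mem_erase]
    constructor
    · rintro (rfl | ⟨hyz, hyb', _, hyg⟩)
      · exact ⟨hzb.symm, h.2.2.1, hb⟩
      · exact ⟨hyz, hyb', hyg⟩
    · rintro ⟨hyz, hyb', hyg⟩
      by_cases hyb : y = b
      · exact Or.inl hyb
      · exact Or.inr ⟨hyz, hyb', hyb, hyg⟩
  rw [e1] at h1
  have h3 : rk N (((gr N).erase b').erase z) = rk N (gr N) := by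
    have hle : rk N (((gr N).erase b').erase z) ≤ rk N (gr N) :=
      rk_mono' (M := N) ((erase_subset _ _).trans (erase_subset _ _))
    have hge : rk N ((gr N).erase b') ≤ rk N (((gr N).erase b').erase z) + 1 := by
      have := rk_insert_le (M := N) z (((gr N).erase b').erase z)
      rwa [insert_erase (mem_erase.2 ⟨hzb', hzg⟩)] at this
    rw [h.2.2.2.2.1] at hge
    by_contra hne
    have h6 : rk N (((gr N).erase b').erase z) + 1 = rk N (gr N) := by omega
    exact hno z hzg hzb ⟨hb', hzg, hzb'.symm, h.2.2.2.2.1, hcf z hzg, h6⟩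
  omega

/-- A series pair of the contraction `N ／ a` (`a` a non-loop outside the pair) is a series pair of `N`. -/
theorem seriesPair_of_seriesPair_contract {a b b' : α} (ha : a ∈ gr N) (hind : N.Indep ({a} : Set α))
    (hab : a ≠ b) (hab' : a ≠ b') (h : SeriesPair (N ／ ({a} : Set α)) b b') : SeriesPair N b b' := by
  obtain ⟨hb, hb', hbb', hcb, hcb', hser⟩ := h
  have hgr : gr (N ／ ({a} : Set α)) = (gr N).erase a := gr_contract'
  rw [hgr] at hb hb' hcb hcb' hser
  have hE := rk_gr_contract_add_one hind ha
  rw [hgr] at hE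
  have h1 := rk_contract_add_one hind (X := ((gr N).erase a).erase b) (erase_subset _ _)
  have h2 := rk_contract_add_one hind (X := ((gr N).erase a).erase b') (erase_subset _ _)
  have h3 := rk_contract_add_one hind (X := (((gr N).erase a).erase b).erase b')
    ((erase_subset _ _).trans (erase_subset _ _))
  have e1 : insert a (((gr N).erase a).erase b) = (gr N).erase b := by
    rw [erase_right_comm, insert_erase (mem_erase.2 ⟨hab, ha⟩)]
  have e2 : insert a (((gr N).erase a).erase b') = (gr N).erase b' := by
    rw [erase_right_comm, insert_erase (mem_erase.2 ⟨hab', ha⟩)]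
  have e3 : insert a ((((gr N).erase a).erase b).erase b') = ((gr N).erase b).erase b' := by
    have : (((gr N).erase a).erase b).erase b' = (((gr N).erase b).erase b').erase a := by
      ext x
      simp only [mem_erase]
      tauto
    rw [this, insert_erase (mem_erase.2 ⟨hab', mem_erase.2 ⟨hab, ha⟩⟩)]
  rw [e1] at h1
  rw [e2] at h2
  rw [e3] at h3
  exact ⟨(mem_erase.1 hb).2, (mem_erase.1 hb').2, hbb', by omega, by omega, by omega⟩

end StarSharpM

end PercRepro.Cogirth
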